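import Summits.ValiantsHypothesis.ValiantsHypothesis.Theorems.KPlusLogSqLawStaticPathOpt

/-!
# Route «KPlusLogSqLaw» — parametric max-weight independent set on a path: DISTINCT prefix-sum values force a UNIQUE optimum

HONEST FRAMING.  Helper toward the crux `WeakLifting` (item `stmt-ValiantsHypothesis-19561`, route `KPlusLogSqLaw`, cell `pub-symmetroid`,
seat val-sym-lift-p4 g8, 2026-08-27) on the line of its witness-plan stub `stub_tridiagonalSectorB` (tropical twin of the STATIC tridiagonal
sector = parametric maximum-weight independent set on a path = Eppstein's parametric closure problem on the fence, arXiv:1504.04073).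
The chain theorems of the sector (val-sym-lift-p3 g6 `StaticPathFold.chain_le`; this seat's `…StaticPathRecords/Order/Events/Crossings`)
carry the hypothesis «the optimum at the sample parameter is UNIQUE».  This file discharges it from the natural genericity condition: if the
signed prefix-sum lines `S_0, …, S_n` of the block take PAIRWISE DISTINCT values at `θ`, the optimal independent subset at `θ` is unique
(`eq_of_opt_of_distinct`, `unique_of_distinct`).  Mechanism (DP, no polytope theory): two optima that differ on the last item force the tie
`opt i (n-1) = opt i (n-2) + W (i+n)`, i.e. `Δ_{n-1} = W_n` for the left train, and by `fold_alt_eq` / `fold_eq_lab` this reads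
`S_n(θ) = S_j(θ)` for the active index `j = lab (n-1) < n`; otherwise induct on `n`.  (Polytope reading, not formalised: the optimal face of
the path's stable-set polytope is a vertex unless the objective is orthogonal to an edge, and edges are single alternating runs whose weight
telescopes to `S_q - S_p`.)  Statements about a path DP; nothing here asserts anything about `WeakLifting`, `TropicalB`, `KPlusLogSqLaw`,
the stub in its window, `MatrixDescartes` (stmt-ValiantsHypothesis-18050) or `VP ≠ VNP`.
-/

set_option linter.dupNamespace false
set_option autoImplicit false

namespace Summit.ValiantsHypothesis.ValiantsHypothesis.Theorems.KPlusLogSqLaw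

open Finset Classical

namespace StaticPathFold

noncomputable section

variable (w₁ w₀ : ℕ → ℝ)

/-- an independent subset of the block `i+1, …, i+n` avoiding the last item is an independent subset of the block `i+1, …, i+n-1`. [folklore] -/
theorem mem_indepSets_pred_of_not_mem {i n : ℕ} {M : Finset ℕ} (hM : M ∈ indepSets i n) (hn : i + n ∉ M) :
    M ∈ indepSets i (n - 1) := by
  rcases mem_indepSets.mp hM with ⟨hM1, hM2⟩
  refine mem_indepSets.mpr ⟨fun t ht => ?_, hM2⟩
  have h := mem_Ioc.mp (hM1 ht)
  have hne : t ≠ i + n := fun he => hn (he ▸ ht)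
  rw [mem_Ioc]; omega

/-- an independent subset of the block `i+1, …, i+n` containing the last item, minus that item, is an independent subset of the block
`i+1, …, i+n-2`. [folklore] -/
theorem erase_mem_indepSets_of_mem {i n : ℕ} {M : Finset ℕ} (hM : M ∈ indepSets i n) (hn : i + n ∈ M) :
    M.erase (i + n) ∈ indepSets i (n - 2) := by
  rcases mem_indepSets.mp hM with ⟨hM1, hM2⟩
  refine mem_indepSets.mpr ⟨fun t ht => ?_, fun t ht ht1 => hM2 t (mem_of_mem_erase ht) (mem_of_mem_erase ht1)⟩
  rw [mem_erase] at ht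
  have h := mem_Ioc.mp (hM1 ht.2)
  -- `t ≠ i + n`, and `t = i + n - 1` is excluded by independence
  have hne : t ≠ i + n - 1 := by
    intro he
    have h1 : t + 1 = i + n := by omega
    exact hM2 t ht.2 (h1 ▸ hn)
  rw [mem_Ioc]; omega

/-- the value of an optimal set containing the last item: `opt i n = opt i (n-2) + W (i+n)`, and its remainder is optimal for the block
`i+1, …, i+n-2`. [folklore] -/
theorem opt_eq_of_opt_mem_last {i n : ℕ} {θ : ℝ} {M : Finset ℕ} (hM : M ∈ indepSets i n)
    (hopt : ∑ t ∈ M, W w₁ w₀ t θ = opt w₁ w₀ i n θ) (hn : i + n ∈ M) :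
    opt w₁ w₀ i n θ = opt w₁ w₀ i (n - 2) θ + W w₁ w₀ (i + n) θ ∧
      ∑ t ∈ M.erase (i + n), W w₁ w₀ t θ = opt w₁ w₀ i (n - 2) θ := by
  have hE := erase_mem_indepSets_of_mem hM hn
  have hsplit : ∑ t ∈ M, W w₁ w₀ t θ = ∑ t ∈ M.erase (i + n), W w₁ w₀ t θ + W w₁ w₀ (i + n) θ := by
    rw [← sum_erase_add _ _ hn]
  have hup : ∑ t ∈ M.erase (i + n), W w₁ w₀ t θ ≤ opt w₁ w₀ i (n - 2) θ := sum_le_opt w₁ w₀ hE θ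
  -- gluing an optimal set of the block `i+1..i+n-2` with the item `i+n`
  have hn1 : 1 ≤ n := by
    rcases mem_indepSets.mp hM with ⟨hM1, _⟩
    have := mem_Ioc.mp (hM1 hn); omega
  have hB : ({i + n} : Finset ℕ) ∈ indepSets (i + n - 1) 1 := by
    refine mem_indepSets.mpr ⟨fun t ht => ?_, fun t ht ht1 => ?_⟩
    · rw [mem_singleton] at ht; rw [mem_Ioc]; omega
    · rw [mem_singleton] at ht ht1; omega
  have hlow : opt w₁ w₀ i (n - 2) θ + W w₁ w₀ (i + n) θ ≤ opt w₁ w₀ i n θ := by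
    rcases Nat.lt_or_ge n 2 with hn2 | hn2
    · -- `n = 1`: the left block is empty
      have hn' : n = 1 := by omega
      subst hn'
      rw [show (1 : ℕ) - 2 = 0 from rfl, opt_zero, zero_add]
      have hB' : ({i + 1} : Finset ℕ) ∈ indepSets i 1 := by rwa [Nat.add_sub_cancel] at hB
      simpa using sum_le_opt w₁ w₀ hB' θ
    · obtain ⟨A, hA, hAopt⟩ := exists_opt_eq w₁ w₀ i (n - 2) θ
      have hU : A ∪ {i + n} ∈ indepSets i n := union_mem_indepSets hA hB (by omega) (by omega)
      have hs := sum_union_of_blocks w₁ w₀ hA hB (by omega) θ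
      rw [sum_singleton] at hs
      rw [hAopt, ← hs]
      exact sum_le_opt w₁ w₀ hU θ
  constructor
  · linarith
  · linarith

/-- **DISTINCT PREFIX-SUM VALUES FORCE A UNIQUE OPTIMUM**: if the signed prefix-sum lines `S_0, …, S_n` of the block `i+1, …, i+n` take pairwise
distinct values at `θ`, two optimal independent subsets coincide. [folklore] -/
theorem eq_of_opt_of_distinct (i : ℕ) : ∀ (n : ℕ) (θ : ℝ),
    (∀ p q, p ≤ n → q ≤ n → p ≠ q → L (altA (shift i w₁)) (altB (shift i w₀)) p θ ≠ L (altA (shift i w₁)) (altB (shift i w₀)) q θ) →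
    ∀ M M' : Finset ℕ, M ∈ indepSets i n → M' ∈ indepSets i n →
      ∑ t ∈ M, W w₁ w₀ t θ = opt w₁ w₀ i n θ → ∑ t ∈ M', W w₁ w₀ t θ = opt w₁ w₀ i n θ → M = M' := by
  intro n
  induction n using Nat.strong_induction_on with
  | _ n ih =>
    intro θ hdis M M' hM hM' hopt hopt'
    -- monotonicity facts
    have hmono : ∀ k, opt w₁ w₀ i k θ ≤ opt w₁ w₀ i (k + 1) θ := fun k => by
      have h := opt_sub_eq_Δ w₁ w₀ i k θ
      have h2 := Δ_nonneg (shift i w₁) (shift i w₀) (k + 1) θ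
      linarith
    -- the key tie is impossible: `opt i (n-1) = opt i (n-2) + W (i+n)` would force `S_n = S_(lab (n-1))`
    have notie : 1 ≤ n → opt w₁ w₀ i (n - 1) θ ≠ opt w₁ w₀ i (n - 2) θ + W w₁ w₀ (i + n) θ := by
      intro hn htie
      obtain ⟨k, rfl⟩ : ∃ k, n = k + 1 := ⟨n - 1, by omega⟩
      simp only [Nat.add_sub_cancel] at htie
      -- `Δ (shift i) k θ = W (i+k+1) θ`
      have hΔ : Δ (shift i w₁) (shift i w₀) k θ = W w₁ w₀ (i + (k + 1)) θ := by
        rcases Nat.eq_zero_or_pos k with hk | hk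
        · subst hk
          rw [show (0 : ℕ) + 1 - 2 = 0 from rfl, opt_zero] at htie
          show (0 : ℝ) = _
          linarith
        · have h := opt_sub_eq_Δ w₁ w₀ i (k - 1) θ
          rw [Nat.sub_add_cancel hk] at h
          rw [show k + 1 - 2 = k - 1 by omega] at htie
          linarith
      -- read it on the prefix-sum lines: `W (i+k+1) = (-1)^(k+1) (S (k+1) - S k)` and `fold k = S k ∓ Δ k = S (lab k)`
      have hS := L_alt_succ (shift i w₁) (shift i w₀) k θ
      rw [W_shift] at hS
      have hF := fold_alt_eq (shift i w₁) (shift i w₀) k θ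
      rw [fold_eq_lab] at hF
      have hj : lab (altA (shift i w₁)) (altB (shift i w₀)) k θ ≤ k := lab_le _ _ k θ
      apply hdis (k + 1) (lab (altA (shift i w₁)) (altB (shift i w₀)) k θ) le_rfl (by omega) (by omega)
      rcases Nat.even_or_odd k with he | ho
      · rw [if_pos he] at hF
        have hodd : Odd (k + 1) := he.add_one
        rw [hodd.neg_one_pow] at hS
        linarith
      · have hne : ¬ Even k := Nat.not_even_iff_odd.mpr ho
        rw [if_neg hne] at hF
        have hev : Even (k + 1) := ho.add_one
        rw [hev.neg_one_pow] at hS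
        linarith
    by_cases hn : i + n ∈ M <;> by_cases hn' : i + n ∈ M'
    · -- both contain the last item: remainders are optimal two levels down
      have h1 := opt_eq_of_opt_mem_last w₁ w₀ hM hopt hn
      have h2 := opt_eq_of_opt_mem_last w₁ w₀ hM' hopt' hn'
      have hn1 : 1 ≤ n := by
        rcases mem_indepSets.mp hM with ⟨hM1, _⟩
        have := mem_Ioc.mp (hM1 hn); omega
      have hE := ih (n - 2) (by omega) θ (fun p q hp hq hpq => hdis p q (by omega) (by omega) hpq) _ _
        (erase_mem_indepSets_of_mem hM hn) (erase_mem_indepSets_of_mem hM' hn') h1.2 h2.2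
      rw [← insert_erase hn, ← insert_erase hn', hE]
    · -- `M` contains the last item, `M'` does not: the forbidden tie
      exfalso
      have h1 := opt_eq_of_opt_mem_last w₁ w₀ hM hopt hn
      have hM'' := mem_indepSets_pred_of_not_mem hM' hn'
      have hn1 : 1 ≤ n := by
        rcases mem_indepSets.mp hM with ⟨hM1, _⟩
        have := mem_Ioc.mp (hM1 hn); omega
      have h3 : opt w₁ w₀ i n θ ≤ opt w₁ w₀ i (n - 1) θ := by rw [← hopt']; exact sum_le_opt w₁ w₀ hM'' θ
      have h4 : opt w₁ w₀ i (n - 1) θ ≤ opt w₁ w₀ i n θ := by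
        have := hmono (n - 1); rwa [Nat.sub_add_cancel hn1] at this
      exact notie hn1 (by linarith [h1.1])
    · exfalso
      have h1 := opt_eq_of_opt_mem_last w₁ w₀ hM' hopt' hn'
      have hM'' := mem_indepSets_pred_of_not_mem hM hn
      have hn1 : 1 ≤ n := by
        rcases mem_indepSets.mp hM' with ⟨hM1, _⟩
        have := mem_Ioc.mp (hM1 hn'); omega
      have h3 : opt w₁ w₀ i n θ ≤ opt w₁ w₀ i (n - 1) θ := by rw [← hopt]; exact sum_le_opt w₁ w₀ hM'' θ
      have h4 : opt w₁ w₀ i (n - 1) θ ≤ opt w₁ w₀ i n θ := by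
        have := hmono (n - 1); rwa [Nat.sub_add_cancel hn1] at this
      exact notie hn1 (by linarith [h1.1])
    · -- neither contains the last item: both are optimal one level down (or `n = 0`)
      rcases Nat.eq_zero_or_pos n with hn0 | hn0
      · subst hn0
        rcases mem_indepSets.mp hM with ⟨hM1, _⟩
        rcases mem_indepSets.mp hM' with ⟨hM1', _⟩
        have e1 : M = ∅ := subset_empty.mp (by simpa using hM1)
        have e2 : M' = ∅ := subset_empty.mp (by simpa using hM1')
        rw [e1, e2]
      · have hMp := mem_indepSets_pred_of_not_mem hM hn
        have hMp' := mem_indepSets_pred_of_not_mem hM' hn'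
        have h4 : opt w₁ w₀ i (n - 1) θ ≤ opt w₁ w₀ i n θ := by
          have := hmono (n - 1); rwa [Nat.sub_add_cancel hn0] at this
        have hoptp : ∑ t ∈ M, W w₁ w₀ t θ = opt w₁ w₀ i (n - 1) θ :=
          le_antisymm (sum_le_opt w₁ w₀ hMp θ) (by rw [hopt]; exact h4)
        have hoptp' : ∑ t ∈ M', W w₁ w₀ t θ = opt w₁ w₀ i (n - 1) θ :=
          le_antisymm (sum_le_opt w₁ w₀ hMp' θ) (by rw [hopt']; exact h4)
        exact ih (n - 1) (by omega) θ (fun p q hp hq hpq => hdis p q (by omega) (by omega) hpq) _ _ hMp hMp' hoptp hoptp'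

/-- **UNIQUE OPTIMUM FROM DISTINCT PREFIX-SUM VALUES** (the form consumed by the chain theorems): if the prefix-sum lines take pairwise
distinct values at `θ` and `M` is an optimal independent subset, every other independent subset weighs strictly less. [folklore] -/
theorem unique_of_distinct {i n : ℕ} {θ : ℝ} {M : Finset ℕ}
    (hdis : ∀ p q, p ≤ n → q ≤ n → p ≠ q →
      L (altA (shift i w₁)) (altB (shift i w₀)) p θ ≠ L (altA (shift i w₁)) (altB (shift i w₀)) q θ)
    (hM : M ∈ indepSets i n) (hopt : ∑ t ∈ M, W w₁ w₀ t θ = opt w₁ w₀ i n θ) :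
    ∀ S ∈ indepSets i n, S ≠ M → ∑ t ∈ S, W w₁ w₀ t θ < ∑ t ∈ M, W w₁ w₀ t θ := by
  intro S hS hSM
  refine lt_of_le_of_ne (hopt ▸ sum_le_opt w₁ w₀ hS θ) fun heq => hSM ?_
  exact eq_of_opt_of_distinct w₁ w₀ i n θ hdis S M hS hM (heq.trans hopt) hopt

end

end StaticPathFold

end Summit.ValiantsHypothesis.ValiantsHypothesis.Theorems.KPlusLogSqLaw
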